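import Summits.KontsevichZagierPeriods.KontsevichZagierPeriods.Theorems.SymplecticScissorsRealOnePeriodRelationsStubTorsArcsC
import Summits.KontsevichZagierPeriods.KontsevichZagierPeriods.Theorems.SymplecticScissorsRealOnePeriodRelationsStubTorsTailC
import Summits.KontsevichZagierPeriods.KontsevichZagierPeriods.Theorems.SymplecticScissorsRealOnePeriodRelationsTorsionLayerFamily

/-!
# Crux `RealOnePeriodRelations` (stmt-KontsevichZagierPeriods-10042), line `nash-retraction-thin-strip`, reshape 11 (lead, cycle 9):
# torsion cells with COMPLEX-CONJUGATE torsion poles and torsion TAILS, on families of non-CM curves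

Generators added on top of the reshape-10 torsion layer (`…TorsionLayerFamily.lean`):
* `(P, D)`-cells `∫_a^b P(x) dx/(D(x) √f_j(x))`, `P, D ∈ (ℚ̄ ∩ ℝ)[x]`, `D ≠ 0` on `[a, b]`, EVERY complex root of `D` a torsion
  abscissa `℘_{L_j}(v)` of `E_j : y² = f_j(x) = x³ + A_j x + B_j` (complex-conjugate pairs of poles allowed) — realised by one symbol on the
  torsion-punctured curve `C_T`, `T` = the root set of `D` (`stub_torsArcsC`, worker);
* `(P, D)`-tails `∫_M^∞ P(x) dx/(D(x) √f_j(x))`, `deg P ≤ deg D`, `D ≠ 0` on `[M, ∞)`, roots torsion abscissae, `M > e` = the largest real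
  root of `f_j` — reduced to a `(P, D)`-cell on `(e, e + f_j′(e)/(M − e))` by the `2`-torsion translation `x ↦ e + f_j′(e)/(x − e)`, ONE
  instance of rule (2) (`stub_torsTailC`, worker; `℘(v + ω_e) = e + f′(e)/(℘ v − e)` keeps the poles torsion).
Glue (lead): `torsCellsC_family`, `torsLayerArcsC_family`, and the layer theorem `realOnePeriodRelations_torsionLayerC_family` by
`SectorGlue.realOnePeriodRelations_of_sector` over the reshape-10 apex sector `huberWustholzCurvePeriods_torsionPunctured_family`
(no new transcendence input).  With this file the third-kind elliptic sector of the crux is complete relative to the tree's engine: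
what remains (open paths on CM curves, NON-torsion residue divisors = `𝔾ₘ`-extensions of `E`, genus `≥ 2` beyond split Jacobians) is
the apex `HuberWustholzCurvePeriods` itself.
[cite: HuberWustholz2022, Thm 13.3 (2), §13.2, Ch. 15] [cite: KontsevichZagier2001, §1.2]
-/

noncomputable section

open scoped BigOperators Topology PeriodPair
open Set Filter MvPolynomial Complex MeasureTheory
open Literature.NumberTheory.Transcendental Literature.NumberTheory.Transcendental.CurvePeriods
open Literature.NumberTheory.Transcendental.CurvePeriods.Ell
open Summit.KontsevichZagierPeriods.SymplecticScissors.RealOnePeriodRelationsNegative (M₁ H₁)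

namespace Summit.KontsevichZagierPeriods.SymplecticScissors.RealOnePeriodRelations

namespace TorsionLayer

/-! ## The real clothes (cycle 9): cells and arcs on families -/

section Layer

variable {ι : Type} (A B : ι → ℝ) (L : ι → PeriodPair)

/-- CELLS of the cycle-9 torsion layer: rational representations, elliptic cells and tails by `IsoLayer.isoCells`; `(P, D)`-torsion
cells as they stand; `(P, D)`-torsion tails become `(P, D)`-torsion cells by `stub_torsTailC`. [cite: KontsevichZagier2001, §1.2] -/
theorem torsCellsC_family (hA : ∀ j, IsAlgebraic ℚ (A j)) (hB : ∀ j, IsAlgebraic ℚ (B j))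
    (hL₂ : ∀ j, (L j).g₂ = -4 * (A j : ℂ)) (hL₃ : ∀ j, (L j).g₃ = -4 * (B j : ℂ)) :
    ∀ c : KZ.FormalRep, c ∈ AddSubgroup.closure ((fun r : KZ.IntegralRep 1 => KZ.of r) ''
      {r | r.IsRational ∨
        (∃ j, ∃ a b : ℝ, IsAlgebraic ℚ a ∧ IsAlgebraic ℚ b ∧ a < b ∧ r.domain = {z | z 0 ∈ Set.Ioo a b} ∧
          (∀ x ∈ Set.Ioo a b, 0 < x ^ 3 + A j * x + B j) ∧
          ∃ P₁ P₂ P₃ : Polynomial (algebraicClosure ℚ ℝ), ∀ x ∈ Set.Ioo a b,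
            r.integrand (fun _ => x) = Polynomial.aeval x P₁ + Polynomial.aeval x P₂ * Real.sqrt (x ^ 3 + A j * x + B j) +
              Polynomial.aeval x P₃ / Real.sqrt (x ^ 3 + A j * x + B j)) ∨
        (∃ j, ∃ e M' c₀ : ℝ, IsAlgebraic ℚ e ∧ IsAlgebraic ℚ M' ∧ IsAlgebraic ℚ c₀ ∧ e ^ 3 + A j * e + B j = 0 ∧
          0 < 3 * e ^ 2 + A j ∧ e < M' ∧ (∀ x : ℝ, e < x → 0 < x ^ 3 + A j * x + B j) ∧ r.domain = {z | M' < z 0} ∧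
          ∀ z ∈ r.domain, r.integrand z = c₀ / Real.sqrt ((z 0) ^ 3 + A j * (z 0) + B j)) ∨
        (∃ j, ∃ a b : ℝ, IsAlgebraic ℚ a ∧ IsAlgebraic ℚ b ∧ a < b ∧ r.domain = {z | z 0 ∈ Set.Ioo a b} ∧
          (∀ x ∈ Set.Ioo a b, 0 < x ^ 3 + A j * x + B j) ∧
          ∃ P D : Polynomial (algebraicClosure ℚ ℝ), (∀ x ∈ Set.Icc a b, Polynomial.aeval x D ≠ 0) ∧
            (∀ z : ℂ, Polynomial.aeval z D = 0 →
              ∃ v : ℂ, v ∉ (L j).lattice ∧ (∃ n : ℕ, 1 ≤ n ∧ (n : ℂ) * v ∈ (L j).lattice) ∧ ℘[L j] v = z) ∧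
            ∀ x ∈ Set.Ioo a b, r.integrand (fun _ => x) =
              Polynomial.aeval x P / (Polynomial.aeval x D * Real.sqrt (x ^ 3 + A j * x + B j))) ∨
        (∃ j, ∃ e M' : ℝ, IsAlgebraic ℚ e ∧ IsAlgebraic ℚ M' ∧ e ^ 3 + A j * e + B j = 0 ∧ 0 < 3 * e ^ 2 + A j ∧ e < M' ∧
          (∀ x : ℝ, e < x → 0 < x ^ 3 + A j * x + B j) ∧ r.domain = {z | M' < z 0} ∧
          ∃ P D : Polynomial (algebraicClosure ℚ ℝ), P.natDegree ≤ D.natDegree ∧ (∀ x : ℝ, M' ≤ x → Polynomial.aeval x D ≠ 0) ∧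
            (∀ z : ℂ, Polynomial.aeval z D = 0 →
              ∃ v : ℂ, v ∉ (L j).lattice ∧ (∃ n : ℕ, 1 ≤ n ∧ (n : ℂ) * v ∈ (L j).lattice) ∧ ℘[L j] v = z) ∧
            ∀ z ∈ r.domain, r.integrand z =
              Polynomial.aeval (z 0) P / (Polynomial.aeval (z 0) D * Real.sqrt ((z 0) ^ 3 + A j * (z 0) + B j)))}) →
    ∃ N : KZ.IntegralRep 1 →₀ ℤ, (∀ ρ ∈ N.support,
      (ρ.domain = {z | z 0 ∈ Set.Ioo (0 : ℝ) 1} ∧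
          ∃ P Q : Polynomial (algebraicClosure ℚ ℝ),
            (∀ t ∈ Set.Ioo (0 : ℝ) 1, Polynomial.aeval t Q ≠ 0) ∧
            ∀ t ∈ Set.Ioo (0 : ℝ) 1, ρ.integrand (fun _ => t) = Polynomial.aeval t P / Polynomial.aeval t Q) ∨
        (∃ j, ∃ a b : ℝ, IsAlgebraic ℚ a ∧ IsAlgebraic ℚ b ∧ a < b ∧ ρ.domain = {z | z 0 ∈ Set.Ioo a b} ∧
          (∀ x ∈ Set.Ioo a b, 0 < x ^ 3 + A j * x + B j) ∧
          ∃ P₁ P₂ P₃ : Polynomial (algebraicClosure ℚ ℝ), ∀ x ∈ Set.Ioo a b,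
            ρ.integrand (fun _ => x) = Polynomial.aeval x P₁ + Polynomial.aeval x P₂ * Real.sqrt (x ^ 3 + A j * x + B j) +
              Polynomial.aeval x P₃ / Real.sqrt (x ^ 3 + A j * x + B j)) ∨
        (∃ j, ∃ a b : ℝ, IsAlgebraic ℚ a ∧ IsAlgebraic ℚ b ∧ a < b ∧ ρ.domain = {z | z 0 ∈ Set.Ioo a b} ∧
          (∀ x ∈ Set.Ioo a b, 0 < x ^ 3 + A j * x + B j) ∧
          ∃ P D : Polynomial (algebraicClosure ℚ ℝ), (∀ x ∈ Set.Icc a b, Polynomial.aeval x D ≠ 0) ∧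
            (∀ z : ℂ, Polynomial.aeval z D = 0 →
              ∃ v : ℂ, v ∉ (L j).lattice ∧ (∃ n : ℕ, 1 ≤ n ∧ (n : ℂ) * v ∈ (L j).lattice) ∧ ℘[L j] v = z) ∧
            ∀ x ∈ Set.Ioo a b, ρ.integrand (fun _ => x) =
              Polynomial.aeval x P / (Polynomial.aeval x D * Real.sqrt (x ^ 3 + A j * x + B j)))) ∧
      c - N.sum (fun ρ m => m • KZ.of ρ) ∈ M₁ := by
  classical
  intro c hc
  refine AddSubgroup.closure_induction (p := fun c _ => ∃ N : KZ.IntegralRep 1 →₀ ℤ, (∀ ρ ∈ N.support,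
      (ρ.domain = {z | z 0 ∈ Set.Ioo (0 : ℝ) 1} ∧
          ∃ P Q : Polynomial (algebraicClosure ℚ ℝ),
            (∀ t ∈ Set.Ioo (0 : ℝ) 1, Polynomial.aeval t Q ≠ 0) ∧
            ∀ t ∈ Set.Ioo (0 : ℝ) 1, ρ.integrand (fun _ => t) = Polynomial.aeval t P / Polynomial.aeval t Q) ∨
        (∃ j, ∃ a b : ℝ, IsAlgebraic ℚ a ∧ IsAlgebraic ℚ b ∧ a < b ∧ ρ.domain = {z | z 0 ∈ Set.Ioo a b} ∧
          (∀ x ∈ Set.Ioo a b, 0 < x ^ 3 + A j * x + B j) ∧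
          ∃ P₁ P₂ P₃ : Polynomial (algebraicClosure ℚ ℝ), ∀ x ∈ Set.Ioo a b,
            ρ.integrand (fun _ => x) = Polynomial.aeval x P₁ + Polynomial.aeval x P₂ * Real.sqrt (x ^ 3 + A j * x + B j) +
              Polynomial.aeval x P₃ / Real.sqrt (x ^ 3 + A j * x + B j)) ∨
        (∃ j, ∃ a b : ℝ, IsAlgebraic ℚ a ∧ IsAlgebraic ℚ b ∧ a < b ∧ ρ.domain = {z | z 0 ∈ Set.Ioo a b} ∧
          (∀ x ∈ Set.Ioo a b, 0 < x ^ 3 + A j * x + B j) ∧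
          ∃ P D : Polynomial (algebraicClosure ℚ ℝ), (∀ x ∈ Set.Icc a b, Polynomial.aeval x D ≠ 0) ∧
            (∀ z : ℂ, Polynomial.aeval z D = 0 →
              ∃ v : ℂ, v ∉ (L j).lattice ∧ (∃ n : ℕ, 1 ≤ n ∧ (n : ℂ) * v ∈ (L j).lattice) ∧ ℘[L j] v = z) ∧
            ∀ x ∈ Set.Ioo a b, ρ.integrand (fun _ => x) =
              Polynomial.aeval x P / (Polynomial.aeval x D * Real.sqrt (x ^ 3 + A j * x + B j)))) ∧
      c - N.sum (fun ρ m => m • KZ.of ρ) ∈ M₁) ?_ ?_ ?_ ?_ hc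
  · -- generators
    rintro _ ⟨r, hr, rfl⟩
    rcases hr with hrat | hcell | htail | htors | ⟨j, e, M', he, hM', hfe, hfe', heM, hpos, hdom, P, D, hPD, hD0, hDt, hint⟩
    · obtain ⟨N, hN, hrN⟩ := IsoLayer.isoCells A B hA hB (KZ.of r) (AddSubgroup.subset_closure ⟨r, Or.inl hrat, rfl⟩)
      exact ⟨N, fun ρ hρ => (hN ρ hρ).elim Or.inl (fun h => Or.inr (Or.inl h)), hrN⟩
    · obtain ⟨N, hN, hrN⟩ := IsoLayer.isoCells A B hA hB (KZ.of r) (AddSubgroup.subset_closure ⟨r, Or.inr (Or.inl hcell), rfl⟩)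
      exact ⟨N, fun ρ hρ => (hN ρ hρ).elim Or.inl (fun h => Or.inr (Or.inl h)), hrN⟩
    · obtain ⟨N, hN, hrN⟩ := IsoLayer.isoCells A B hA hB (KZ.of r) (AddSubgroup.subset_closure ⟨r, Or.inr (Or.inr htail), rfl⟩)
      exact ⟨N, fun ρ hρ => (hN ρ hρ).elim Or.inl (fun h => Or.inr (Or.inl h)), hrN⟩
    · refine ⟨Finsupp.single r 1, fun ρ hρ => ?_, ?_⟩
      · rw [Finsupp.support_single _ one_ne_zero, Finset.mem_singleton] at hρ
        subst hρ
        exact Or.inr (Or.inr htors)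
      · rw [Finsupp.sum_single_index (zero_zsmul _), one_zsmul, sub_self]
        exact M₁.zero_mem
    · obtain ⟨r', hr', hrr'⟩ := stub_torsTailC (A j) (B j) e M' (hA j) (hB j) he hM' hfe hfe' heM hpos (L j) (hL₂ j) (hL₃ j)
        P D hPD hD0 hDt r hdom hint
      refine ⟨Finsupp.single r' 1, fun ρ hρ => ?_, ?_⟩
      · rw [Finsupp.support_single _ one_ne_zero, Finset.mem_singleton] at hρ
        subst hρ
        exact Or.inr (Or.inr ⟨j, hr'⟩)
      · rw [Finsupp.sum_single_index (zero_zsmul _), one_zsmul]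
        exact hrr'
  · exact ⟨0, by simp, by simp [M₁.zero_mem]⟩
  · rintro c c' _ _ ⟨N, hN, hcN⟩ ⟨N', hN', hcN'⟩
    refine ⟨N + N', fun ρ hρ => ?_, ?_⟩
    · rcases Finset.mem_union.mp (Finsupp.support_add hρ) with h | h
      · exact hN ρ h
      · exact hN' ρ h
    · rw [Cells.combo_add]
      convert M₁.add_mem hcN hcN' using 1
      abel
  · rintro c _ ⟨N, hN, hcN⟩
    refine ⟨-N, fun ρ hρ => hN ρ (by simpa [Finsupp.support_neg] using hρ), ?_⟩
    rw [Cells.combo_neg]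
    convert M₁.neg_mem hcN using 1
    abel

/-- ARCS of the cycle-9 torsion layer: `IsoLayer.isoArcs` on rational and elliptic cells, `stub_torsArcsC` on `(P, D)`-torsion cells.
[cite: HuberWustholz2022, §3.3.1] -/
theorem torsLayerArcsC_family (hA : ∀ j, IsAlgebraic ℚ (A j)) (hB : ∀ j, IsAlgebraic ℚ (B j)) (hD : ∀ j, 4 * A j ^ 3 + 27 * B j ^ 2 ≠ 0)
    (hL₂ : ∀ j, (L j).g₂ = -4 * (A j : ℂ)) (hL₃ : ∀ j, (L j).g₃ = -4 * (B j : ℂ)) :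
    ∀ ρ : KZ.IntegralRep 1,
    ((ρ.domain = {z | z 0 ∈ Set.Ioo (0 : ℝ) 1} ∧
          ∃ P Q : Polynomial (algebraicClosure ℚ ℝ),
            (∀ t ∈ Set.Ioo (0 : ℝ) 1, Polynomial.aeval t Q ≠ 0) ∧
            ∀ t ∈ Set.Ioo (0 : ℝ) 1, ρ.integrand (fun _ => t) = Polynomial.aeval t P / Polynomial.aeval t Q) ∨
        (∃ j, ∃ a b : ℝ, IsAlgebraic ℚ a ∧ IsAlgebraic ℚ b ∧ a < b ∧ ρ.domain = {z | z 0 ∈ Set.Ioo a b} ∧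
          (∀ x ∈ Set.Ioo a b, 0 < x ^ 3 + A j * x + B j) ∧
          ∃ P₁ P₂ P₃ : Polynomial (algebraicClosure ℚ ℝ), ∀ x ∈ Set.Ioo a b,
            ρ.integrand (fun _ => x) = Polynomial.aeval x P₁ + Polynomial.aeval x P₂ * Real.sqrt (x ^ 3 + A j * x + B j) +
              Polynomial.aeval x P₃ / Real.sqrt (x ^ 3 + A j * x + B j)) ∨
        (∃ j, ∃ a b : ℝ, IsAlgebraic ℚ a ∧ IsAlgebraic ℚ b ∧ a < b ∧ ρ.domain = {z | z 0 ∈ Set.Ioo a b} ∧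
          (∀ x ∈ Set.Ioo a b, 0 < x ^ 3 + A j * x + B j) ∧
          ∃ P D : Polynomial (algebraicClosure ℚ ℝ), (∀ x ∈ Set.Icc a b, Polynomial.aeval x D ≠ 0) ∧
            (∀ z : ℂ, Polynomial.aeval z D = 0 →
              ∃ v : ℂ, v ∉ (L j).lattice ∧ (∃ n : ℕ, 1 ≤ n ∧ (n : ℂ) * v ∈ (L j).lattice) ∧ ℘[L j] v = z) ∧
            ∀ x ∈ Set.Ioo a b, ρ.integrand (fun _ => x) =
              Polynomial.aeval x P / (Polynomial.aeval x D * Real.sqrt (x ^ 3 + A j * x + B j)))) →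
    ∃ (C : PeriodSymbol →₀ ℂ) (R : PeriodSymbol → KZ.IntegralRep 1), (∀ s, IsAlgebraic ℚ (C s)) ∧
      (∀ s ∈ C.support,
        (∃ j, ∃ T : Finset ℂ, (∀ a ∈ T, ∃ v : ℂ, IsAlgPt (L j) v ∧ (∃ n : ℕ, 1 ≤ n ∧ (n : ℂ) * v ∈ (L j).lattice) ∧ ℘[L j] v = a) ∧
          s.Z = curveP (L j) T) ∨
        (∃ (r : ℕ) (a : Fin r → ℂ), Function.Injective a ∧ (∀ i, IsAlgebraic ℚ (a i)) ∧
          s.Z = (⟨2, 1, ![X 1 * ∏ i, (X 0 - MvPolynomial.C (a i)) - 1]⟩ : CurveData)) ∨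
        ∃ j, s.Z = weierCurve (A j : ℂ) (B j : ℂ)) ∧
      (∀ s ∈ C.support, IsSemialgebraicMapOn ℚ {z : Fin 1 → ℝ | z 0 ∈ Set.Icc (0 : ℝ) 1}
        (fun z => Fin.append (fun i => (s.γ.toFun (z 0) i).re) (fun i => (s.γ.toFun (z 0) i).im))) ∧
      (∀ s ∈ C.support, (R s).domain = {z | z 0 ∈ Set.Ioo (0 : ℝ) 1} ∧ ∀ z ∈ (R s).domain, (R s).integrand z =
        (C s * ∑ i, MvPolynomial.eval (s.γ.toFun (z 0)) (s.ω i) * deriv (fun u => s.γ.toFun u i) (z 0)).re) ∧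
      evalCombination C = ((ρ.value : ℝ) : ℂ) ∧ KZ.of ρ - ∑ s ∈ C.support, KZ.of (R s) ∈ M₁ := by
  rintro ρ (hrat | hcell | ⟨j, htors⟩)
  · obtain ⟨C, R, h1, h2, h3, h4, h5, h6⟩ := IsoLayer.isoArcs A B hA hB hD ρ (Or.inl hrat)
    exact ⟨C, R, h1, fun s hs => Or.inr (h2 s hs), h3, h4, h5, h6⟩
  · obtain ⟨C, R, h1, h2, h3, h4, h5, h6⟩ := IsoLayer.isoArcs A B hA hB hD ρ (Or.inr hcell)
    exact ⟨C, R, h1, fun s hs => Or.inr (h2 s hs), h3, h4, h5, h6⟩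
  · obtain ⟨C, R, h1, h2, h3, h4, h5, h6⟩ := stub_torsArcsC (A j) (B j) (hA j) (hB j) (hD j) (L j) (hL₂ j) (hL₃ j) ρ htors
    exact ⟨C, R, h1, fun s hs => Or.inl ⟨j, h2 s hs⟩, h3, h4, h5, h6⟩

end Layer


/-- **THE CYCLE-9 TORSION LAYER OF THE CRUX ON FAMILIES, UNCONDITIONALLY.**  As `realOnePeriodRelations_torsionLayer_family`, with the
torsion cells now `(P, D)`-cells `∫_a^b P dx/(D √f_j)` whose poles are ALL complex roots of `D ∈ (ℚ̄ ∩ ℝ)[x]` (conjugate pairs allowed),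
torsion abscissae of `E_j`, `D ≠ 0` on `[a, b]`, and with torsion TAILS `∫_M^∞ P dx/(D √f_j)` (`deg P ≤ deg D`).  Proof:
`SectorGlue.realOnePeriodRelations_of_sector` with `torsCellsC_family`, `torsLayerArcsC_family` and the reshape-10 sector theorem
`huberWustholzCurvePeriods_torsionPunctured_family`.
[cite: HuberWustholz2022, Thm 13.3 (2), §13.2, Ch. 15] [cite: KontsevichZagier2001, §1.2] -/
theorem realOnePeriodRelations_torsionLayerC_family : ∀ {ι J : Type} [Fintype J] [DecidableEq J]
    (A B : ι → ℝ), (∀ j, IsAlgebraic ℚ (A j)) → (∀ j, IsAlgebraic ℚ (B j)) →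
    ∀ (M : J → PeriodPair), (∀ i, IsAlgebraic ℚ (M i).g₂ ∧ IsAlgebraic ℚ (M i).g₃) →
    (∀ i j, i ≠ j → ¬ (M i).IsIsogenousTo (M j)) → (∀ i, ¬ (M i).HasCM) →
    ∀ (L : ι → PeriodPair) (κ : ι → J) (α : ι → ℂ), (∀ j, (L j).g₂ = -4 * (A j : ℂ)) → (∀ j, (L j).g₃ = -4 * (B j : ℂ)) →
    (∀ j, α j ≠ 0) → (∀ j, IsAlgebraic ℚ (α j)) → (∀ j, ∀ l ∈ (L j).lattice, α j * l ∈ (M (κ j)).lattice) →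
    ∀ c : KZ.FormalRep, c ∈ AddSubgroup.closure ((fun r : KZ.IntegralRep 1 => KZ.of r) ''
      {r | r.IsRational ∨
        (∃ j, ∃ a b : ℝ, IsAlgebraic ℚ a ∧ IsAlgebraic ℚ b ∧ a < b ∧ r.domain = {z | z 0 ∈ Set.Ioo a b} ∧
          (∀ x ∈ Set.Ioo a b, 0 < x ^ 3 + A j * x + B j) ∧
          ∃ P₁ P₂ P₃ : Polynomial (algebraicClosure ℚ ℝ), ∀ x ∈ Set.Ioo a b,
            r.integrand (fun _ => x) = Polynomial.aeval x P₁ + Polynomial.aeval x P₂ * Real.sqrt (x ^ 3 + A j * x + B j) +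
              Polynomial.aeval x P₃ / Real.sqrt (x ^ 3 + A j * x + B j)) ∨
        (∃ j, ∃ e M' c₀ : ℝ, IsAlgebraic ℚ e ∧ IsAlgebraic ℚ M' ∧ IsAlgebraic ℚ c₀ ∧ e ^ 3 + A j * e + B j = 0 ∧
          0 < 3 * e ^ 2 + A j ∧ e < M' ∧ (∀ x : ℝ, e < x → 0 < x ^ 3 + A j * x + B j) ∧ r.domain = {z | M' < z 0} ∧
          ∀ z ∈ r.domain, r.integrand z = c₀ / Real.sqrt ((z 0) ^ 3 + A j * (z 0) + B j)) ∨
        (∃ j, ∃ a b : ℝ, IsAlgebraic ℚ a ∧ IsAlgebraic ℚ b ∧ a < b ∧ r.domain = {z | z 0 ∈ Set.Ioo a b} ∧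
          (∀ x ∈ Set.Ioo a b, 0 < x ^ 3 + A j * x + B j) ∧
          ∃ P D : Polynomial (algebraicClosure ℚ ℝ), (∀ x ∈ Set.Icc a b, Polynomial.aeval x D ≠ 0) ∧
            (∀ z : ℂ, Polynomial.aeval z D = 0 →
              ∃ v : ℂ, v ∉ (L j).lattice ∧ (∃ n : ℕ, 1 ≤ n ∧ (n : ℂ) * v ∈ (L j).lattice) ∧ ℘[L j] v = z) ∧
            ∀ x ∈ Set.Ioo a b, r.integrand (fun _ => x) =
              Polynomial.aeval x P / (Polynomial.aeval x D * Real.sqrt (x ^ 3 + A j * x + B j))) ∨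
        (∃ j, ∃ e M' : ℝ, IsAlgebraic ℚ e ∧ IsAlgebraic ℚ M' ∧ e ^ 3 + A j * e + B j = 0 ∧ 0 < 3 * e ^ 2 + A j ∧ e < M' ∧
          (∀ x : ℝ, e < x → 0 < x ^ 3 + A j * x + B j) ∧ r.domain = {z | M' < z 0} ∧
          ∃ P D : Polynomial (algebraicClosure ℚ ℝ), P.natDegree ≤ D.natDegree ∧ (∀ x : ℝ, M' ≤ x → Polynomial.aeval x D ≠ 0) ∧
            (∀ z : ℂ, Polynomial.aeval z D = 0 →
              ∃ v : ℂ, v ∉ (L j).lattice ∧ (∃ n : ℕ, 1 ≤ n ∧ (n : ℂ) * v ∈ (L j).lattice) ∧ ℘[L j] v = z) ∧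
            ∀ z ∈ r.domain, r.integrand z =
              Polynomial.aeval (z 0) P / (Polynomial.aeval (z 0) D * Real.sqrt ((z 0) ^ 3 + A j * (z 0) + B j)))}) →
    KZ.eval c = 0 →
    c ∈ AddSubgroup.closure (KZ.domainAddRel ∪ KZ.integrandAddRel ∪ KZ.changeOfVariablesRel ∪
      {g : KZ.FormalRep | ∃ (Δ : Set (Fin 2 → ℝ)) (A B S : (Fin 2 → ℝ) → ℝ) (r₀₁ r₁₂ r₀₂ : KZ.IntegralRep 1),
        Δ = {p | 0 ≤ p 0 ∧ 0 ≤ p 1 ∧ p 0 + p 1 ≤ 1} ∧ IsSemialgebraicFunOn ℚ Δ A ∧ IsSemialgebraicFunOn ℚ Δ B ∧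
        ContinuousOn A Δ ∧ ContinuousOn B Δ ∧
        (∀ p : Fin 2 → ℝ, 0 < p 0 → 0 < p 1 → p 0 + p 1 < 1 →
          HasFDerivAt S (A p • ContinuousLinearMap.proj (R := ℝ) (φ := fun _ : Fin 2 => ℝ) 0 +
            B p • ContinuousLinearMap.proj (R := ℝ) (φ := fun _ : Fin 2 => ℝ) 1) p) ∧
        r₀₁.domain = {z | z 0 ∈ Set.Ioo 0 1} ∧ r₁₂.domain = {z | z 0 ∈ Set.Ioo 0 1} ∧
        r₀₂.domain = {z | z 0 ∈ Set.Ioo 0 1} ∧ (∀ z ∈ r₀₁.domain, r₀₁.integrand z = A ![z 0, 0]) ∧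
        (∀ z ∈ r₁₂.domain, r₁₂.integrand z = B ![1 - z 0, z 0] - A ![1 - z 0, z 0]) ∧
        (∀ z ∈ r₀₂.domain, r₀₂.integrand z = B ![0, z 0]) ∧ g = KZ.of r₀₁ + KZ.of r₁₂ - KZ.of r₀₂}) := by
  intro ι J _ _ A B hA hB M hM hiso hCM L κ α hL₂ hL₃ hα hαalg hαM c hc heval
  change c ∈ M₁
  have hD : ∀ j, 4 * A j ^ 3 + 27 * B j ^ 2 ≠ 0 := fun j => discr_ne_zero_of_model (L j) (hL₂ j) (hL₃ j)
  have hg₂ : ∀ j, IsAlgebraic ℚ (L j).g₂ := fun j => by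
    rw [hL₂ j]; exact ((isAlgebraic_int 4).neg).mul (hA j).algebraMap
  have hg₃ : ∀ j, IsAlgebraic ℚ (L j).g₃ := fun j => by
    rw [hL₃ j]; exact ((isAlgebraic_int 4).neg).mul (hB j).algebraMap
  refine SectorGlue.realOnePeriodRelations_of_sector _ _ _ (fun C hCalg hCsupp hC0 => ?_)
    (torsCellsC_family A B L hA hB hL₂ hL₃) (torsLayerArcsC_family A B L hA hB hD hL₂ hL₃) c hc heval
  refine huberWustholzCurvePeriods_torsionPunctured_family M hM hiso hCM C hCalg (fun s hs => ?_) hC0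
  rcases hCsupp s hs with ⟨j, T, hT, hZ⟩ | hP | ⟨j, hj⟩
  · exact Or.inl ⟨κ j, L j, α j, hg₂ j, hg₃ j, hα j, hαalg j, hαM j, Or.inr ⟨T, hT, hZ⟩⟩
  · exact Or.inr (Or.inl hP)
  · exact Or.inl ⟨κ j, L j, α j, hg₂ j, hg₃ j, hα j, hαalg j, hαM j,
      Or.inl (hj.trans (Ell.curve_eq_weierCurve (hL₂ j) (hL₃ j)).symm)⟩

end TorsionLayer

end Summit.KontsevichZagierPeriods.SymplecticScissors.RealOnePeriodRelations

end
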